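import Summits.Parity.GeneralizedHardyLittlewood.Theorems.FordMaynardSieveConst01651SieveConst01651LinePart06
import HarnessLib

/-!
# Route `FordMaynardSieveConst01651`, target `SieveConst01651` (stmt-Parity-19185): line `sieve_decomposition` re-homed — proofs, part 7 of 11 (file 8 of 12)

File 8 of 12 of the VERBATIM re-homing under `Theorems/` of the registered line skeleton
`Summits/Parity/GeneralizedHardyLittlewood/Cruxes/SieveConst01651/Lines/sieve_decomposition.lean` (v21, sha16
`ada6d0765119a11e`; author seat `linewriter-parity-smallroutes-1`, g0 v1–v20 / g1 v21): Ford–Maynard, Theorem 7.3 (a) at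
`P = (1/2, 0, ν)` with CLOSED support, cut along arXiv:2407.14368 §7.2 / §6.2, composed down to the route target
`Summit.Parity.GeneralizedHardyLittlewood.Theses.FordMaynardSieveConst01651.SieveConst01651`.  Namespace
`Summit.Parity.GeneralizedHardyLittlewood.FordMaynardSieveConst01651SieveDecomposition` (fresh; the `Cruxes` copy keeps its own), files of
≤ 400 lines chained by import; the three registered stubs are replaced by their landed proofs
(`…StubSignClauseFive` p834287, `…StubCertValuePos` p837763, `…TypeIIRegion` p833045), so the skeleton's composition
`SieveConst01651_of_stubs` (last part) is sorry-free.  Mathematics, statements and comments are the linewriter's; this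
re-homing (hand `leafhand-parity-fordmaynardsieveco-2` g4) only moved the definitions (`Eset`, `sliceTest`, `mainG1`, `vk`,
the `Signature.*` statement abbreviations, `Phi`, `innerI`, `jumpSet`, `gval`, `symmExt`, `idxProd`, `gam`) into the first
file, added docstrings where missing, and renamed two unused binders.
Declarations in this part: `sign_p2`, `sign_of_not_squarefree`, `sign_lemma`, `mem_SFset`, `mem_NSFset`, `sum_Nset_eq_SF_add_NSF`, `sum_Ioc_inv_sq_le`, `card_NSFset_le`, `rpow_half_le_half_rpow`, `sum_SFset_Hwt_eq`, `mainTerm_of_sqfree`, `mem_SFkset`, `sieveBoundG1_eq`, `starSum_vk_eq`, `sum_SFset_fiberwise`.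

References: [FordMaynard2024PrimeSieves] K. Ford, J. Maynard, *On the theory of prime producing sieves*, arXiv:2407.14368,
Theorem 7.3 (a), Proposition 7.19, §6.2, §7.2, §8.2.
-/

noncomputable section

open Finset
open Literature.NumberTheory.Sieve Literature.NumberTheory.Sieve.FordMaynard Literature.Barriers.Parity.FordMaynard
open Summit.Parity.GeneralizedHardyLittlewood.FordMaynardSieveConst01651SieveConst01651
  (hfun Admissible hfun_apply hfun_of_ne pvec roughPart smoothPart Gwt Hwt window IsRough Nset Rset mem_window mem_Nset mem_Rset
   coneCert openSmall stub_hkPieces stub_coneCertClosed_of_residues' coneCert_signClause_five_of_generic)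

namespace Summit.Parity.GeneralizedHardyLittlewood.FordMaynardSieveConst01651SieveDecomposition

/-- `sign_p2` — lemma of the line skeleton `sieve_decomposition` (v21, seat `linewriter-parity-smallroutes-1`), re-homed verbatim. [folklore] -/
theorem sign_p2 {ν : ℝ} (hν : 0 < ν) (hν4 : ν < 1 / 4) {g : VecFn} (hadm : Admissible ν g) {n p m : ℕ}
    (hn : 2 ≤ n) (hr : IsRough ν n) (hp : p.Prime) (hpm : ¬ p ∣ m) (hm1 : 1 < m) (hmsq : Squarefree m)
    (hnpm : n = p ^ 2 * m) (hp4 : (n : ℝ) ^ (1 / 4 : ℝ) < p) :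
    ∑ d ∈ n.divisors, g d.primeFactorsList.length (pvec n d) ≤ 0 := by
  have hm : m ≠ 0 := by omega
  have hpm0 : p * m ≠ 0 := mul_ne_zero hp.ne_zero hm
  have hpmsq : Squarefree (p * m) := by
    rw [Nat.squarefree_mul ((Nat.Prime.coprime_iff_not_dvd hp).2 hpm)]
    exact ⟨Irreducible.squarefree hp, hmsq⟩
  have hs : g.IsSymmetric := hadm.1
  rw [sum_divisors_eq_sum_divisors_mul hadm hn hp hpm hm (by norm_num) hnpm hp4,
    sum_divisors_eq_starSum n hpm0 hpmsq, starSum_eq_sum_gam hs]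
  have hQ := sum_gam_eq_of_coe_eq g (coe_ofFn_pvec_mul n hp hm) id
  simp only [id] at hQ
  rw [hQ]
  have hnpos : (0 : ℝ) < n := by exact_mod_cast (by omega : 0 < n)
  have hlogn : 0 < Real.log n := Real.log_pos (by exact_mod_cast (by omega : 1 < n))
  have hlogp : Real.log n < 4 * Real.log p := by
    have h := Real.log_lt_log (Real.rpow_pos_of_pos hnpos _) hp4
    rw [Real.log_rpow hnpos] at h
    linarith
  have hxp : 1 / 4 < Real.log p / Real.log n := by rw [lt_div_iff₀ hlogn]; linarith
  have hxpν : ν < Real.log p / Real.log n := by linarith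
  have hmdvd : m ∣ n := by rw [hnpm]; exact dvd_mul_left m _
  have hypos : ∀ i, 0 ≤ pvec n m i := fun i => pvec_nonneg hn _ i
  have hylow : ∀ i, ν < pvec n m i := fun i => nu_lt_pvec hn hr hmdvd i
  have hsumy : ∑ i, pvec n m i = Real.log m / Real.log n := _root_.Summit.Parity.GeneralizedHardyLittlewood.FordMaynardSieveConst01651SieveConst01651.sum_pvec' hm
  have hlognn : Real.log n = 2 * Real.log p + Real.log m := by
    rw [hnpm]
    push_cast
    rw [Real.log_mul (pow_ne_zero _ (by exact_mod_cast hp.ne_zero)) (by exact_mod_cast hm), Real.log_pow]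
    push_cast
    ring
  have hk1 : 1 ≤ m.primeFactorsList.length := by
    obtain ⟨q, hq, hqm⟩ := Nat.exists_prime_and_dvd (by omega : m ≠ 1)
    exact List.length_pos_of_mem ((Nat.mem_primeFactorsList hm).2 ⟨hq, hqm⟩)
  have hsum2 : ∑ i, (Fin.snoc (pvec n m) (2 * (Real.log p / Real.log n)) :
      Fin (m.primeFactorsList.length + 1) → ℝ) i = 1 := by
    rw [Fin.sum_snoc, hsumy]
    have : Real.log m / Real.log n + 2 * (Real.log p / Real.log n)
        = (2 * Real.log p + Real.log m) / Real.log n := by ring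
    rw [this, ← hlognn, div_self hlogn.ne']
  have hA0 : ∑ B' : Finset (Fin m.primeFactorsList.length), gam g (B'.val.map (pvec n m)) ≤ 0 := by
    rw [← starSum_eq_sum_gam hs,
      ← starSum_snoc_of_half_lt hadm (pvec n m) hypos (t := 2 * (Real.log p / Real.log n)) (by linarith)]
    exact hadm.2.2.2.2 _ (by omega) _
      (entries_of_sum_eq_one (by omega) (fun l => hν.le.trans (forall_snoc_lt hylow (by linarith) l).le)
        (forall_snoc_lt hylow (by linarith)) hsum2) hsum2
  have hsum3 : ∑ i, (Fin.snoc (Fin.snoc (pvec n m) (Real.log p / Real.log n) :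
      Fin (m.primeFactorsList.length + 1) → ℝ) (Real.log p / Real.log n) :
      Fin (m.primeFactorsList.length + 1 + 1) → ℝ) i = 1 := by
    rw [Fin.sum_snoc, Fin.sum_snoc, hsumy]
    have : Real.log m / Real.log n + Real.log p / Real.log n + Real.log p / Real.log n
        = (2 * Real.log p + Real.log m) / Real.log n := by ring
    rw [this, ← hlognn, div_self hlogn.ne']
  have hS1 := hadm.2.2.2.2 _ (by omega) _
    (entries_of_sum_eq_one (by omega)
      (fun l => hν.le.trans (forall_snoc_lt (forall_snoc_lt hylow hxpν) hxpν l).le)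
      (forall_snoc_lt (forall_snoc_lt hylow hxpν) hxpν) hsum3) hsum3
  rw [starSum_eq_sum_gam hs] at hS1
  have hB := sum_gam_snoc g (Fin.snoc (pvec n m) (Real.log p / Real.log n) :
      Fin (m.primeFactorsList.length + 1) → ℝ) (Real.log p / Real.log n) id
  simp only [id] at hB
  have hC := sum_gam_snoc g (pvec n m) (Real.log p / Real.log n) (fun s => (Real.log p / Real.log n) ::ₘ s)
  have hzero : ∀ B' : Finset (Fin m.primeFactorsList.length),
      gam g ((Real.log p / Real.log n) ::ₘ ((Real.log p / Real.log n) ::ₘ B'.val.map (pvec n m))) = 0 := by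
    intro B'
    apply gam_eq_zero hadm (Multiset.cons_ne_zero)
    rw [Multiset.sum_cons, Multiset.sum_cons]
    have : 0 ≤ (B'.val.map (pvec n m)).sum :=
      Multiset.sum_nonneg fun r hr' => by
        obtain ⟨i, -, rfl⟩ := Multiset.mem_map.1 hr'
        exact hypos i
    linarith
  simp only [hzero, Finset.sum_const_zero, add_zero] at hC
  have hA := sum_gam_snoc g (pvec n m) (Real.log p / Real.log n) id
  simp only [id] at hA
  rw [hB, hC, hA] at hS1
  rw [hA]
  linarith

/-- `sign_of_not_squarefree` — lemma of the line skeleton `sieve_decomposition` (v21, seat `linewriter-parity-smallroutes-1`), re-homed verbatim. [folklore] -/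
theorem sign_of_not_squarefree {ν : ℝ} (hν : 0 < ν) (hν4 : ν < 1 / 4) {g : VecFn} (hadm : Admissible ν g)
    {n : ℕ} (hn : 2 ≤ n) (hr : IsRough ν n) (hexc : ¬ IsExc n) (hsq : ¬ Squarefree n) :
    ∑ d ∈ n.divisors, g d.primeFactorsList.length (pvec n d) ≤ 0 := by
  obtain ⟨p, m, a, hp, hpm, hmsq, hm0, hcase, hnpam, hp4⟩ := structure_of_not_squarefree hn hexc hsq
  rcases hcase with ⟨rfl, hm1⟩ | rfl
  · exact sign_p2 hν hν4 hadm hn hr hp hpm hm1 hmsq hnpam hp4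
  · exact sign_p3 hν hν4 hadm hn hr hp hpm hm0 hmsq hnpam hp4

/-- `sign_lemma` — lemma of the line skeleton `sieve_decomposition` (v21, seat `linewriter-parity-smallroutes-1`), re-homed verbatim. [folklore] -/
theorem sign_lemma : Signature.signLemma := by
  intro ν hν hν4 g hadm n hn hp hr hexc
  by_cases hsq : Squarefree n
  · exact sign_of_squarefree hadm hn hp hr hsq
  · exact sign_of_not_squarefree hν hν4 hadm hn hr hexc hsq

/-- `mem_SFset` — lemma of the line skeleton `sieve_decomposition` (v21, seat `linewriter-parity-smallroutes-1`), re-homed verbatim. [folklore] -/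
theorem mem_SFset {ν x : ℝ} {n : ℕ} : n ∈ SFset ν x ↔ n ∈ Nset ν x ∧ Squarefree n := by
  unfold SFset; simp [mem_filter]

/-- `mem_NSFset` — lemma of the line skeleton `sieve_decomposition` (v21, seat `linewriter-parity-smallroutes-1`), re-homed verbatim. [folklore] -/
theorem mem_NSFset {ν x : ℝ} {n : ℕ} : n ∈ NSFset ν x ↔ n ∈ Nset ν x ∧ ¬ Squarefree n := by
  unfold NSFset; simp [mem_filter]

/-- `sum_Nset_eq_SF_add_NSF` — lemma of the line skeleton `sieve_decomposition` (v21, seat `linewriter-parity-smallroutes-1`), re-homed verbatim. [folklore] -/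
theorem sum_Nset_eq_SF_add_NSF {ν x : ℝ} (f : ℕ → ℝ) :
    ∑ n ∈ Nset ν x, f n = ∑ n ∈ SFset ν x, f n + ∑ n ∈ NSFset ν x, f n := by
  classical
  have h1 : (Nset ν x).filter Squarefree = SFset ν x := by ext n; rw [mem_filter, mem_SFset]
  have h2 : (Nset ν x).filter (fun n => ¬ Squarefree n) = NSFset ν x := by ext n; rw [mem_filter, mem_NSFset]
  rw [← sum_filter_add_sum_filter_not (Nset ν x) Squarefree f, h1, h2]

/-- `sum_Ioc_inv_sq_le` — lemma of the line skeleton `sieve_decomposition` (v21, seat `linewriter-parity-smallroutes-1`), re-homed verbatim. [folklore] -/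
theorem sum_Ioc_inv_sq_le {Y : ℕ} (hY : 1 ≤ Y) (X : ℕ) :
    ∑ q ∈ Ioc Y X, (1 : ℝ) / ((q : ℝ) ^ 2) ≤ 1 / (Y : ℝ) := by
  rcases Nat.lt_or_ge X Y with hXY | hYX
  swap
  · have key : ∀ X', Y ≤ X' → ∑ q ∈ Ioc Y X', (1 : ℝ) / ((q : ℝ) ^ 2) ≤ 1 / (Y : ℝ) - 1 / (X' : ℝ) := by
      intro X' hYX'
      induction X', hYX' using Nat.le_induction with
      | base => simp
      | succ X' hYX' ih =>
        have hIoc : Ioc Y (X' + 1) = insert (X' + 1) (Ioc Y X') := by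
          ext q; simp only [mem_Ioc, mem_insert]; omega
        have hnot : X' + 1 ∉ Ioc Y X' := by simp
        rw [hIoc, sum_insert hnot]
        have hX'pos : (0 : ℝ) < X' := by exact_mod_cast (show 0 < X' by omega)
        have hstep : (1 : ℝ) / (((X' + 1 : ℕ) : ℝ) ^ 2) ≤ 1 / (X' : ℝ) - 1 / ((X' + 1 : ℕ) : ℝ) := by
          push_cast
          rw [div_sub_div _ _ hX'pos.ne' (by positivity), div_le_div_iff₀ (by positivity) (by positivity)]
          nlinarith
        linarith
    have hXpos : (0 : ℝ) < X := by exact_mod_cast (show 0 < X by omega)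
    linarith [key X hYX, one_div_pos.2 hXpos]
  · rw [Finset.Ioc_eq_empty (by omega), sum_empty]
    positivity

/-- `card_NSFset_le` — lemma of the line skeleton `sieve_decomposition` (v21, seat `linewriter-parity-smallroutes-1`), re-homed verbatim. [folklore] -/
theorem card_NSFset_le {ν x : ℝ} (hν : 0 < ν) (hx : 2 ≤ x) {Y : ℕ} (hY1 : 1 ≤ Y) (hY : (Y : ℝ) ≤ (x / 2) ^ ν) :
    ((NSFset ν x).card : ℝ) ≤ x / Y := by
  classical
  have hx0 : 0 ≤ x := by linarith
  have hsub : NSFset ν x ⊆ (Ioc Y ⌊x⌋₊).biUnion (fun q => (Ioc 0 ⌊x⌋₊).filter (fun n => q ^ 2 ∣ n)) := by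
    intro n hn
    rw [mem_NSFset, mem_Nset, mem_window] at hn
    obtain ⟨⟨⟨⟨hn1, hnx⟩, hxn⟩, hn2, -, hr⟩, hnsq⟩ := hn
    rw [Nat.squarefree_iff_prime_squarefree] at hnsq
    push Not at hnsq
    obtain ⟨q, hq, hqn⟩ := hnsq
    have hn0 : n ≠ 0 := by omega
    have hqpf : q ∈ n.primeFactors := Nat.mem_primeFactors.2 ⟨hq, dvd_trans (dvd_mul_right q q) hqn, hn0⟩
    have hqgt : (n : ℝ) ^ ν < q := hr q hqpf
    have hYq : Y < q := by
      have h1 : (x / 2) ^ ν ≤ (n : ℝ) ^ ν := Real.rpow_le_rpow (by positivity) hxn.le hν.le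
      exact_mod_cast (hY.trans_lt (h1.trans_lt hqgt))
    have hqle : q ≤ ⌊x⌋₊ := (Nat.le_of_dvd (by omega) (dvd_trans (dvd_mul_right q q) hqn)).trans hnx
    rw [mem_biUnion]
    refine ⟨q, mem_Ioc.2 ⟨hYq, hqle⟩, mem_filter.2 ⟨mem_Ioc.2 ⟨by omega, hnx⟩, ?_⟩⟩
    rw [pow_two]; exact hqn
  calc ((NSFset ν x).card : ℝ)
      ≤ (((Ioc Y ⌊x⌋₊).biUnion (fun q => (Ioc 0 ⌊x⌋₊).filter (fun n => q ^ 2 ∣ n))).card : ℝ) := by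
        exact_mod_cast card_le_card hsub
    _ ≤ ∑ q ∈ Ioc Y ⌊x⌋₊, ((((Ioc 0 ⌊x⌋₊).filter (fun n => q ^ 2 ∣ n)).card : ℕ) : ℝ) := by
        exact_mod_cast card_biUnion_le
    _ = ∑ q ∈ Ioc Y ⌊x⌋₊, (((⌊x⌋₊ / q ^ 2 : ℕ)) : ℝ) := by
        refine sum_congr rfl fun q _ => ?_
        rw [Nat.Ioc_filter_dvd_card_eq_div]
    _ ≤ ∑ q ∈ Ioc Y ⌊x⌋₊, x * (1 / ((q : ℝ) ^ 2)) := by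
        refine sum_le_sum fun q hq => ?_
        rw [mem_Ioc] at hq
        have hq0 : (0 : ℝ) < (q : ℝ) ^ 2 := by
          have : (0 : ℝ) < q := by exact_mod_cast (show 0 < q by omega)
          positivity
        calc (((⌊x⌋₊ / q ^ 2 : ℕ)) : ℝ) ≤ (⌊x⌋₊ : ℝ) / ((q ^ 2 : ℕ) : ℝ) := Nat.cast_div_le
          _ = (⌊x⌋₊ : ℝ) / ((q : ℝ) ^ 2) := by push_cast; ring
          _ ≤ x / ((q : ℝ) ^ 2) := div_le_div_of_nonneg_right (Nat.floor_le hx0) hq0.le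
          _ = x * (1 / ((q : ℝ) ^ 2)) := by ring
    _ = x * ∑ q ∈ Ioc Y ⌊x⌋₊, (1 / ((q : ℝ) ^ 2)) := by rw [mul_sum]
    _ ≤ x * (1 / (Y : ℝ)) := mul_le_mul_of_nonneg_left (sum_Ioc_inv_sq_le hY1 _) hx0
    _ = x / Y := by ring

/-- `rpow_half_le_half_rpow` — lemma of the line skeleton `sieve_decomposition` (v21, seat `linewriter-parity-smallroutes-1`), re-homed verbatim. [folklore] -/
theorem rpow_half_le_half_rpow {ν x : ℝ} (hν : 0 < ν) (hx : 4 ≤ x) : x ^ (ν / 2) ≤ (x / 2) ^ ν := by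
  have hx0 : 0 ≤ x := by linarith
  have h4 : (4 : ℝ) ^ (1 / 2 : ℝ) = 2 := by
    rw [show (4 : ℝ) = (2 : ℝ) ^ (2 : ℝ) by norm_num, ← Real.rpow_mul (by norm_num)]
    norm_num
  have hsqrt2 : (2 : ℝ) ≤ x ^ (1 / 2 : ℝ) := by
    have := Real.rpow_le_rpow (by norm_num : (0 : ℝ) ≤ 4) hx (by norm_num : (0 : ℝ) ≤ 1 / 2)
    rwa [h4] at this
  have hsq : x ^ (1 / 2 : ℝ) * x ^ (1 / 2 : ℝ) = x := by
    rw [← Real.rpow_add (by linarith : (0 : ℝ) < x)]; norm_num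
  have hle : x ^ (1 / 2 : ℝ) ≤ x / 2 := by nlinarith [Real.rpow_nonneg hx0 (1 / 2 : ℝ)]
  calc x ^ (ν / 2) = (x ^ (1 / 2 : ℝ)) ^ ν := by rw [← Real.rpow_mul hx0]; congr 1; ring
    _ ≤ (x / 2) ^ ν := Real.rpow_le_rpow (Real.rpow_nonneg hx0 _) hle hν.le

/-- `sum_SFset_Hwt_eq` — lemma of the line skeleton `sieve_decomposition` (v21, seat `linewriter-parity-smallroutes-1`), re-homed verbatim. [folklore] -/
theorem sum_SFset_Hwt_eq {ν : ℝ} {g : VecFn} (hadm : Admissible ν g) (x : ℝ) :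
    ∑ n ∈ SFset ν x, Hwt g ν n = ∑ n ∈ SFset ν x, starSum g n.primeFactorsList.length (pvec n n) := by
  refine sum_congr rfl fun n hn => ?_
  rw [mem_SFset, mem_Nset] at hn
  obtain ⟨⟨-, hn2, -, hr⟩, hsq⟩ := hn
  rw [Hwt_eq_sum_of_rough hadm hn2 hr, sum_divisors_eq_starSum n (by omega) hsq g]

/-- `mainTerm_of_sqfree` — lemma of the line skeleton `sieve_decomposition` (v21, seat `linewriter-parity-smallroutes-1`), re-homed verbatim. [folklore] -/
theorem mainTerm_of_sqfree (hT : Signature.sqfreeMainTerm) : Signature.mainTerm := by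
  intro ν hν hν4 g hadm ε hε
  obtain ⟨M, hM⟩ := Hwt_abs_le hν hadm.2.1
  set M' : ℝ := |M| + 1 with hM'
  have hM'pos : 0 < M' := by positivity
  have hMM' : M ≤ M' := by rw [hM']; linarith [le_abs_self M]
  obtain ⟨x₁, hx₁⟩ := hT ν hν hν4 g hadm (ε / 2) (by positivity)
  set c : ℝ := ε / (4 * M') with hc
  have hcpos : 0 < c := by positivity
  have hν2 : 0 < ν / 2 := by positivity
  have hev : ∀ᶠ x : ℝ in Filter.atTop,
      ((2 : ℝ) ≤ x ^ (ν / 2) ∧ Real.log x ≤ c * x ^ (ν / 2)) ∧ (4 : ℝ) ≤ x := by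
    refine ((Filter.Tendsto.eventually_ge_atTop (tendsto_rpow_atTop hν2) 2).and ?_).and
      (Filter.eventually_ge_atTop 4)
    have hlo := (isLittleO_log_rpow_atTop hν2).def hcpos
    filter_upwards [hlo, Filter.eventually_ge_atTop (1 : ℝ)] with x hx hx1
    rw [Real.norm_eq_abs, Real.norm_eq_abs, abs_of_nonneg (Real.log_nonneg hx1),
      abs_of_nonneg (Real.rpow_nonneg (by linarith) _)] at hx
    exact hx
  obtain ⟨x₂, hx₂⟩ := Filter.eventually_atTop.1 hev
  refine ⟨max x₁ x₂, fun x hx => ?_⟩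
  obtain ⟨⟨hpow2, hlog⟩, hx4⟩ := hx₂ x (le_trans (le_max_right _ _) hx)
  have hxx₁ : x₁ ≤ x := le_trans (le_max_left _ _) hx
  have hx0 : 0 ≤ x := by linarith
  have hlogpos : 0 < Real.log x := Real.log_pos (by linarith)
  set Y : ℕ := ⌊x ^ (ν / 2)⌋₊ with hYdef
  have hY1 : 1 ≤ Y := Nat.le_floor (by push_cast; linarith)
  have hYle : (Y : ℝ) ≤ (x / 2) ^ ν :=
    (Nat.floor_le (Real.rpow_nonneg hx0 _)).trans (rpow_half_le_half_rpow hν hx4)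
  have hYge : x ^ (ν / 2) / 2 ≤ Y := by
    have := Nat.lt_floor_add_one (x ^ (ν / 2))

    linarith
  have hYpos : (0 : ℝ) < Y := by exact_mod_cast (show 0 < Y by omega)
  have hNSF : |∑ n ∈ NSFset ν x, Hwt g ν n| ≤ M' * (x / Y) := by
    calc |∑ n ∈ NSFset ν x, Hwt g ν n| ≤ ∑ n ∈ NSFset ν x, |Hwt g ν n| := abs_sum_le_sum_abs _ _
      _ ≤ ∑ _n ∈ NSFset ν x, M' := by
          refine sum_le_sum fun n hn => ?_
          rw [mem_NSFset, mem_Nset] at hn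
          exact (hM n hn.1.2.1 hn.1.2.2.2).trans hMM'
      _ = M' * (NSFset ν x).card := by rw [sum_const, nsmul_eq_mul]; ring
      _ ≤ M' * (x / Y) := mul_le_mul_of_nonneg_left (card_NSFset_le hν (by linarith) hY1 hYle) hM'pos.le
  have hsmall : M' * (x / Y) ≤ ε / 2 * x / Real.log x := by
    rw [show M' * (x / Y) = M' * x / Y by ring, div_le_div_iff₀ hYpos hlogpos]
    have h1 : Real.log x ≤ c * (2 * Y) := hlog.trans (by nlinarith)
    have h2 : M' * Real.log x ≤ ε / 2 * Y := by
      calc M' * Real.log x ≤ M' * (c * (2 * Y)) := mul_le_mul_of_nonneg_left h1 hM'pos.le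
        _ = ε / 2 * Y := by rw [hc]; field_simp; ring
    nlinarith
  have hSF := hx₁ x hxx₁
  rw [sum_Nset_eq_SF_add_NSF, sum_SFset_Hwt_eq hadm]
  calc |∑ n ∈ SFset ν x, starSum g n.primeFactorsList.length (pvec n n) + ∑ n ∈ NSFset ν x, Hwt g ν n -
          (sieveBoundG1 ν g - 1) * ((windowPrimes x).card : ℝ)|
      = |(∑ n ∈ SFset ν x, starSum g n.primeFactorsList.length (pvec n n) -
          (sieveBoundG1 ν g - 1) * ((windowPrimes x).card : ℝ)) + ∑ n ∈ NSFset ν x, Hwt g ν n| := by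
        congr 1; ring
    _ ≤ |∑ n ∈ SFset ν x, starSum g n.primeFactorsList.length (pvec n n) -
          (sieveBoundG1 ν g - 1) * ((windowPrimes x).card : ℝ)| + |∑ n ∈ NSFset ν x, Hwt g ν n| := abs_add_le _ _
    _ ≤ ε / 2 * x / Real.log x + ε / 2 * x / Real.log x := add_le_add hSF (hNSF.trans hsmall)
    _ = ε * x / Real.log x := by ring

/-- `mem_SFkset` — lemma of the line skeleton `sieve_decomposition` (v21, seat `linewriter-parity-smallroutes-1`), re-homed verbatim. [folklore] -/
theorem mem_SFkset {ν x : ℝ} {k n : ℕ} : n ∈ SFkset ν x k ↔ n ∈ SFset ν x ∧ n.primeFactorsList.length = k := by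
  unfold SFkset; simp [mem_filter]

/-- `sieveBoundG1_eq` — lemma of the line skeleton `sieve_decomposition` (v21, seat `linewriter-parity-smallroutes-1`), re-homed verbatim. [folklore] -/
theorem sieveBoundG1_eq (ν : ℝ) (g : VecFn) :
    sieveBoundG1 ν g = 1 + ∑ k ∈ Icc 2 ⌊1 / ν⌋₊, sliceIntegral k 1 (sliceTest ν g k) := rfl

/-- `starSum_vk_eq` — lemma of the line skeleton `sieve_decomposition` (v21, seat `linewriter-parity-smallroutes-1`), re-homed verbatim. [folklore] -/
theorem starSum_vk_eq (g : VecFn) {k n : ℕ} (hk : n.primeFactorsList.length = k) :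
    starSum g k (vk k n) = starSum g n.primeFactorsList.length (pvec n n) := by
  subst hk
  congr 1
  funext i
  simp only [vk, pvec, List.getD_eq_getElem?_getD, List.getElem?_eq_getElem i.isLt, Option.getD_some,
    List.get_eq_getElem]

/-- `sum_SFset_fiberwise` — lemma of the line skeleton `sieve_decomposition` (v21, seat `linewriter-parity-smallroutes-1`), re-homed verbatim. [folklore] -/
theorem sum_SFset_fiberwise {ν x : ℝ} (hν : 0 < ν) (F : ℕ → ℝ) :
    ∑ n ∈ SFset ν x, F n = ∑ k ∈ Icc 2 ⌊1 / ν⌋₊, ∑ n ∈ SFkset ν x k, F n := by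
  classical
  have hmaps : ∀ n ∈ SFset ν x, n.primeFactorsList.length ∈ Icc 2 ⌊1 / ν⌋₊ := by
    intro n hn
    rw [mem_SFset, mem_Nset] at hn
    obtain ⟨⟨-, hn2, hnp, hr⟩, -⟩ := hn
    rw [mem_Icc]
    refine ⟨two_le_length_of_not_prime hn2 hnp, ?_⟩
    apply Nat.le_floor
    rw [le_div_iff₀ hν]
    exact (length_mul_lt_one_of_rough hn2 hr).le
  rw [← sum_fiberwise_of_maps_to hmaps F]
  refine sum_congr rfl fun k _ => ?_
  apply sum_congr _ (fun _ _ => rfl)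
  ext n
  rw [mem_filter, mem_SFkset]

end Summit.Parity.GeneralizedHardyLittlewood.FordMaynardSieveConst01651SieveDecomposition

end
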